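import Mathlib
import Summits.Ventures.LatticeQCDFlow.Scaling.U1SlabChain

/-!
# LatticeQCDFlow / Scaling — slab chains: the leading coefficient of the tilted covariance when
# the centred kernel has the first observable as an EIGENFUNCTION (abstract, group-free)

HONEST FRAMING: exact (Metropolis-corrected) sampling algorithms for lattice gauge theory;
figures of merit are autocorrelation/cost numbers at stated couplings and volumes; no
continuum-physics claim.

Venture `LatticeQCDFlow` (cell pub-lqcd), topic `Scaling`, FANOUT row 30 (lean-1) — OUR WORK, the
group-free half of the extension of the slab-chain proof of (LC)/(U′) from `U(1)`
(`Scaling/U1CrossCutFloorAllT.lean`) to a general compact gauge group.  In the slab-chain theorem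
`SlabChain.cov_tilt_jetEq` (`Scaling/SlabChainCovariance.lean`) the leading coefficient of
`⟨x(η_0) y(η_τ)⟩_β − ⟨x(η_0)⟩_β ⟨y(η_τ)⟩_β` is the chain integral
`b = ∫ x(η_0) y(η_τ) ∏_{h<τ} ρ_h(η_h, η_{h+1}) dμ^{⊗(n+1)}`.  This file evaluates `b` under the one
hypothesis that makes the `U(1)` computation (`Scaling/U1SlabChain.lean`, eigenvalue `1/16`) work for
any group: the EIGENVALUE RELATION `∫ x(e) ρ_h(e, e') dμ(e) = λ_h · x(e')` for every `h` and `e'`.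
* `integral_chain_eigen_step` — one step along the arc: integrating the free layer `k < τ` replaces
  `x(η_k) ρ_k(η_k, η_{k+1})` by `λ_k x(η_{k+1})` (marginal substitution
  `U1Layer.integral_mul_eq_integral_marginal`);
* `integral_chain_eigen_Ico` — `∫ x(η_k) y(η_τ) ∏_{k ≤ h < τ} ρ_h = (∏_{k ≤ h < τ} λ_h) ∫ x y dμ`;
* **`integral_chain_eigen`** — `b = (∏_{h<τ} λ_h) · ∫ x(e) y(e) dμ(e)`, and for a constant eigenvalue
  **`integral_chain_eigen_const`** — `b = λ^τ · ∫ x y dμ`.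
For `U(1)` this is `(1/16)^τ · (1/2)`; for `SU(N)`, `N ≥ 3`, it will be `(1/(16N⁴))^τ · (1/2)`
[cite: MontvayMunster1994, §3.6.2 (3.437)] once the eigenvalue relation is supplied by the sequel
files.  Elementary (Fubini on a finite product of probability spaces); nothing is cited as a fact;
no `def`, no `sorry`.
-/

noncomputable section

open MeasureTheory Filter Finset
open Summit.Ventures.LatticeQCDFlow.Theory2.Lattice.U1Layer (integral_mul_eq_integral_marginal)

namespace Summit.Ventures.LatticeQCDFlow.Theory2.SlabChain

variable {n : ℕ} {E : Type*} [MeasurableSpace E] (μ : Measure E) [IsProbabilityMeasure μ]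
  {ρ : Fin (n + 1) → E → E → ℂ} {Mρ : ℝ} {x y : E → ℝ} {Bx By : ℝ} {lam : Fin (n + 1) → ℂ}
  (hρm : ∀ h, Measurable (Function.uncurry (ρ h))) (hρb : ∀ h e e', ‖ρ h e e'‖ ≤ Mρ)
  (hxm : Measurable x) (hym : Measurable y) (hxb : ∀ e, |x e| ≤ Bx) (hyb : ∀ e, |y e| ≤ By)
  (heig : ∀ h e', ∫ e, (x e : ℂ) * ρ h e e' ∂μ = lam h * x e')

include hρm hρb hxm hym hxb hyb heig in
/-- **One step along the arc under the eigenvalue relation**: for `k < τ`, integrating the free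
layer `k` replaces `x(η_k) ρ_k(η_k, η_{k+1})` by `λ_k · x(η_{k+1})`. [folklore] -/
theorem integral_chain_eigen_step {τ k : Fin (n + 1)} (hk : k.val < τ.val) :
    ∫ η, (x (η k) : ℂ) * (y (η τ) : ℂ) * chainProd ρ (Finset.Ico k τ) η
        ∂(Measure.pi fun _ : Fin (n + 1) => μ) =
      lam k * ∫ η, (x (η (k + 1)) : ℂ) * (y (η τ) : ℂ) * chainProd ρ (Finset.Ico (k + 1) τ) η
        ∂(Measure.pi fun _ : Fin (n + 1) => μ) := by
  have hkn : k.val < n := by have := τ.isLt; omega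
  have hk1 : (k + 1).val = k.val + 1 := val_add_one_of_val_lt hkn
  have hkmem : k ∈ Finset.Ico k τ := Finset.mem_Ico.2 ⟨le_rfl, Fin.lt_def.2 hk⟩
  have hIco : (Finset.Ico k τ).erase k = Finset.Ico (k + 1) τ := by
    ext h
    simp only [Finset.mem_erase, Finset.mem_Ico, Fin.le_def, Fin.lt_def, hk1, ne_eq, Fin.ext_iff]
    omega
  -- bounds and measurability of the pieces
  have hxm' : Measurable fun e : E => (x e : ℂ) := Complex.measurable_ofReal.comp hxm
  have hym' : Measurable fun e : E => (y e : ℂ) := Complex.measurable_ofReal.comp hym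
  have hxb' : ∀ e : E, ‖(x e : ℂ)‖ ≤ |Bx| := fun e => by
    rw [Complex.norm_real, Real.norm_eq_abs]; exact (hxb e).trans (le_abs_self _)
  have hyb' : ∀ e : E, ‖(y e : ℂ)‖ ≤ |By| := fun e => by
    rw [Complex.norm_real, Real.norm_eq_abs]; exact (hyb e).trans (le_abs_self _)
  -- rewrite the integrand as `F(η) · r(η_k, η_{k+1})` with `F` free of the layer `k`
  set F : (Fin (n + 1) → E) → ℂ := fun η =>
    (y (η τ) : ℂ) * chainProd ρ (Finset.Ico (k + 1) τ) η with hFdef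
  have hsplit : ∀ η : Fin (n + 1) → E,
      (x (η k) : ℂ) * (y (η τ) : ℂ) * chainProd ρ (Finset.Ico k τ) η =
      F η * ((fun e e' => (x e : ℂ) * ρ k e e') (η k) (η (k + 1))) := by
    intro η
    simp only [hFdef, chainProd]
    rw [← Finset.mul_prod_erase _ _ hkmem, hIco]
    ring
  simp_rw [hsplit]
  have hτk : τ ≠ k := fun h => by rw [h] at hk; exact lt_irrefl _ hk
  have hk1k : k + 1 ≠ k := fun h => by
    have := congrArg Fin.val h; rw [hk1] at this; omega
  have hFm : Measurable F := (hym'.comp (measurable_pi_apply τ)).mul (measurable_chainProd hρm _)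
  have hFb : ∀ η, ‖F η‖ ≤ |By| * Mρ ^ (Finset.Ico (k + 1) τ).card := fun η => by
    rw [hFdef, norm_mul]
    exact mul_le_mul (hyb' _) (norm_chainProd_le hρb _ η) (norm_nonneg _) (abs_nonneg _)
  have hne1 : ∀ h ∈ Finset.Ico (k + 1) τ, h ≠ k := by
    intro h hh heq
    have := (Finset.mem_Ico.1 hh).1
    rw [Fin.le_def, hk1, heq] at this
    omega
  have hne2 : ∀ h ∈ Finset.Ico (k + 1) τ, h + 1 ≠ k := by
    intro h hh heq
    have h1 := (Finset.mem_Ico.1 hh).1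
    have h2 := (Finset.mem_Ico.1 hh).2
    rw [Fin.le_def, hk1] at h1
    have hv : (h + 1).val = h.val + 1 :=
      val_add_one_of_val_lt (by rw [Fin.lt_def] at h2; have := τ.isLt; omega)
    have := congrArg Fin.val heq
    rw [hv] at this
    omega
  have hF : ∀ η e, F (Function.update η k e) = F η := by
    intro η e
    simp only [hFdef]
    rw [Function.update_of_ne hτk, chainProd_update hne1 hne2]
  have hrm : Measurable (Function.uncurry fun e e' : E => (x e : ℂ) * ρ k e e') :=
    (hxm'.comp measurable_fst).mul (hρm k)
  have hrb : ∀ e e' : E, ‖(x e : ℂ) * ρ k e e'‖ ≤ |Bx| * Mρ := fun e e' => by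
    rw [norm_mul]; exact mul_le_mul (hxb' e) (hρb k e e') (norm_nonneg _) (abs_nonneg _)
  rw [integral_mul_eq_integral_marginal μ hk1k hFm hFb hF hrm hrb]
  simp_rw [heig k]
  rw [← integral_const_mul]
  refine integral_congr_ae (Eventually.of_forall fun η => ?_)
  simp only [hFdef]
  ring

include hρm hρb hxm hym hxb hyb heig in
/-- **Iteration along the arc**: for `k ≤ τ`,
`∫ x(η_k) y(η_τ) ∏_{k ≤ h < τ} ρ_h(η_h, η_{h+1}) = (∏_{k ≤ h < τ} λ_h) · ∫ x y dμ`. [folklore] -/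
theorem integral_chain_eigen_Ico {τ k : Fin (n + 1)} (hk : k.val ≤ τ.val) :
    ∫ η, (x (η k) : ℂ) * (y (η τ) : ℂ) * chainProd ρ (Finset.Ico k τ) η
        ∂(Measure.pi fun _ : Fin (n + 1) => μ) =
      (∏ h ∈ Finset.Ico k τ, lam h) * ∫ e, (x e : ℂ) * (y e : ℂ) ∂μ := by
  -- induction on the length `m = τ − k` of the arc
  have hstep : ∀ m : ℕ, ∀ k : Fin (n + 1), k.val + m = τ.val →
      ∫ η, (x (η k) : ℂ) * (y (η τ) : ℂ) * chainProd ρ (Finset.Ico k τ) η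
          ∂(Measure.pi fun _ : Fin (n + 1) => μ) =
        (∏ h ∈ Finset.Ico k τ, lam h) * ∫ η, (x (η τ) : ℂ) * (y (η τ) : ℂ)
          ∂(Measure.pi fun _ : Fin (n + 1) => μ) := by
    intro m
    induction m with
    | zero =>
        intro k hk
        have hkτ : k = τ := Fin.ext (by omega)
        subst hkτ
        rw [Finset.Ico_self, prod_empty, one_mul]
        refine integral_congr_ae (Eventually.of_forall fun η => ?_)
        simp [chainProd]
    | succ m ih =>
        intro k hk
        have hkτ : k.val < τ.val := by omega
        have hk1 : (k + 1).val = k.val + 1 := val_add_one_of_val_lt (by have := τ.isLt; omega)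
        have hmem : k ∈ Finset.Ico k τ := Finset.mem_Ico.2 ⟨le_rfl, Fin.lt_def.2 hkτ⟩
        have hIco : (Finset.Ico k τ).erase k = Finset.Ico (k + 1) τ := by
          ext h
          simp only [Finset.mem_erase, Finset.mem_Ico, Fin.le_def, Fin.lt_def, hk1, ne_eq, Fin.ext_iff]
          omega
        rw [integral_chain_eigen_step μ hρm hρb hxm hym hxb hyb heig hkτ, ih (k + 1) (by omega),
          ← mul_assoc, ← Finset.mul_prod_erase _ _ hmem, hIco]
  rw [hstep (τ.val - k.val) k (by omega)]
  congr 1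
  -- the marginal at the layer `τ`
  have hmp := MeasureTheory.measurePreserving_eval (fun _ : Fin (n + 1) => μ) τ
  have hg : AEStronglyMeasurable (fun e : E => (x e : ℂ) * (y e : ℂ))
      ((Measure.pi fun _ : Fin (n + 1) => μ).map (Function.eval τ)) :=
    ((Complex.measurable_ofReal.comp hxm).mul (Complex.measurable_ofReal.comp hym)).aestronglyMeasurable
  have h1 := integral_map hmp.measurable.aemeasurable hg
  rw [hmp.map_eq] at h1
  rw [h1]

include hρm hρb hxm hym hxb hyb heig in
/-- **THE LEADING COEFFICIENT UNDER THE EIGENVALUE RELATION.**  If `∫ x(e) ρ_h(e, e') dμ(e) =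
λ_h x(e')` for every `h` and `e'`, then the constant `b` of the slab-chain theorem
`SlabChain.cov_tilt_jetEq` is `∫ x(η_0) y(η_τ) ∏_{h<τ} ρ_h(η_h, η_{h+1}) dμ^{⊗(n+1)} =
(∏_{h<τ} λ_h) · ∫ x(e) y(e) dμ(e)`. [folklore] -/
theorem integral_chain_eigen (τ : Fin (n + 1)) :
    ∫ η, (x (η 0) : ℂ) * (y (η τ) : ℂ) * chainProd ρ (Finset.Iio τ) η
        ∂(Measure.pi fun _ : Fin (n + 1) => μ) =
      (∏ h ∈ Finset.Iio τ, lam h) * ∫ e, (x e : ℂ) * (y e : ℂ) ∂μ := by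
  have h0 : Finset.Iio τ = Finset.Ico (0 : Fin (n + 1)) τ := by
    ext h; simp
  rw [h0]
  exact integral_chain_eigen_Ico μ hρm hρb hxm hym hxb hyb heig (by simp)

/-- **Constant eigenvalue**: if `∫ x(e) ρ_h(e, e') dμ(e) = λ x(e')` for every `h`, `e'`, then
`∫ x(η_0) y(η_τ) ∏_{h<τ} ρ_h(η_h, η_{h+1}) dμ^{⊗(n+1)} = λ^τ · ∫ x y dμ`; for `U(1)` plaquettes this is
`(1/16)^τ · (1/2)` (`U1Layer.integral_chain_xObs`), for `SU(N)`, `N ≥ 3`, it is `(16N⁴)^{-τ}/2`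
[cite: MontvayMunster1994, §3.6.2 (3.437)]. [folklore] -/
theorem integral_chain_eigen_const {c : ℂ}
    (hρm : ∀ h, Measurable (Function.uncurry (ρ h))) (hρb : ∀ h e e', ‖ρ h e e'‖ ≤ Mρ)
    (hxm : Measurable x) (hym : Measurable y) (hxb : ∀ e, |x e| ≤ Bx) (hyb : ∀ e, |y e| ≤ By)
    (heig : ∀ h e', ∫ e, (x e : ℂ) * ρ h e e' ∂μ = c * x e') (τ : Fin (n + 1)) :
    ∫ η, (x (η 0) : ℂ) * (y (η τ) : ℂ) * chainProd ρ (Finset.Iio τ) η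
        ∂(Measure.pi fun _ : Fin (n + 1) => μ) =
      c ^ τ.val * ∫ e, (x e : ℂ) * (y e : ℂ) ∂μ := by
  rw [integral_chain_eigen μ hρm hρb hxm hym hxb hyb (lam := fun _ => c) heig τ, prod_const]
  congr 2
  rw [Fin.card_Iio]

end Summit.Ventures.LatticeQCDFlow.Theory2.SlabChain

end
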